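import Literature.MathematicalPhysics.QuantumFieldTheory.Balaban1983to89.B8Eq195Linear

/-!
# `Balaban1983to89.B8Eq195LinearRange` — T. Bałaban, *Spaces of regular gauge field configurations on a lattice and gauge fixing conditions*,
# Commun. Math. Phys. **99** (1985) 75–102 [Balaban1985RegularSpaces] ("B8"), Sect. D pp. 92–93: the linear-algebra skeleton of (1.93) → (1.95) → (1.100)
# (`B8Eq195Linear`) WITH THE LAW OF THE LETTER `C` IN RANGE FORM — «`Q′G′²Q′ᵀC(Q′f) = Q′f`» ([4] (3.25): `C` inverts `Q′G′²Q′ᵀ` on the range of `Q′`)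

statement-level skeleton of published theorems with citation tags; proofs where landed; nothing here is a claim about the
Yang–Mills mass gap

PDF held: `paper:balaban1985-cmp99-regular-spaces-gauge-fixing` (journal page = PDF page + 74), pp. 91–93 [PDF 17–19]; [4] = [Balaban1985BackgroundPropagators]
(3.24)–(3.25) p. 394.

WHY THIS FILE (cell `pub-ymgap`, R134 acceleration seat `pub-ymgap-dag-n05-d` (g2), DAG node N05 = [B8]; dag-lead REBALANCE №54 (a) — the W8 junction repair;
count-neutral).  `B8Eq195Linear` (n05-a g4) proves print's three operator identities «Q′G′R = 0», «RΔλ = Δλ for Q′λ = 0», «ΔG′R = R» and the equivalence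
«λ = G′R(Y − Nλ) ⟺ Q′λ = 0 ∧ Landau condition» over arbitrary modules `E`, `F` from the (3.25) inverse laws, with the law of `c = C` stated in the FULL-SPACE form
`c_right : ∀ φ : F, q (g (g (qs (c φ)))) = φ`.  Referee dag-ref-A g12 (W8, READ-7/READ-11, kernel-certified): on the concrete carriers that form is violated by [4]'s
operators (`Q′` vanishes off `𝔅_k`) and is FALSE at every member with finite `Ω₀`; print's `C = (Q′G′²Q′ᵀ)⁻¹` inverts ON THE RANGE OF `Q′` only.  THE OBSERVATION OF THIS
FILE: in `B8Eq195Linear` the law is consumed exactly once — `q_g_proj325` applies it at `φ := q (g f)`, a point of the range of `q` — so every identity of that file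
holds VERBATIM under the range form `c_range : ∀ f : E, q (g (g (qs (c (q f))))) = q f`.  The six identities are re-proved here with that one binder re-typed
(signatures otherwise byte-identical; `B8Eq195Linear`'s `c`-free lemmas `proj325_sub`, `proj325_lap_of_ker`, `lap_eq_proj325_iff_of_ker` are used by name), plus the
one-line implication full-space ⇒ range.  Consumers: `B8Prop5JoinSectELocalRange` (the Sect. D/E JOIN in range form), `B8SockHFPRange`.

WHAT THIS FILE PROVES (kernel, 0 sorry, theorems only, no `def`; ring `𝕜`, modules `E`, `F` arbitrary): `c_range_of_c_right`; `q_g_proj325_range` («Q′G′R = 0»),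
`lap_g_proj325_range` («ΔG′R = R»), `proj325_idem_range` (R² = R), `eq_g_proj325_iff_range` ((1.95) ⟺ (1.100)), `fixedPoint_iff_constraint_and_landau_range`,
`fixedPoint_iff_constraint_and_multiplier_range` — each the namesake of `B8Eq195Linear` with `c_right` replaced by `c_range`.

HONEST SCOPE.  Linear algebra only, as in `B8Eq195Linear`; nothing about existence of the fixed point, the letters' existence ([4] Thm 3.11 = in-edge b9) or
bounds.  Count-neutral; N05 is not discharged by this file; nothing continuum / ℝ⁴ / OS / mass-gap / Clay.  Unit `pub-ymgap-dag-n05-d` (g2), 2026-08-26.  Tree API by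
name only, nothing restated.
-/

namespace Literature.MathematicalPhysics.QuantumFieldTheory.Balaban1983to89.B8Eq195LinearRange

open B8Eq138Multiplier B8Eq195Linear

section Skeleton

variable {𝕜 : Type*} [Ring 𝕜] {E F : Type*} [AddCommGroup E] [Module 𝕜 E] [AddCommGroup F] [Module 𝕜 F]
variable {Δ : E →ₗ[𝕜] E} {q : E →ₗ[𝕜] F} {qs : F →ₗ[𝕜] E} {A : F →ₗ[𝕜] F} {g : E →ₗ[𝕜] E} {c : F →ₗ[𝕜] F}
variable {R : E → E}

/-- The full-space law `∀ φ, Q′G′²Q′ᵀ(Cφ) = φ` implies the range-form law `∀ f, Q′G′²Q′ᵀ(C(Q′f)) = Q′f` (specialise at `φ := Q′f`); the converse fails in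
general (dag-ref-A W8). [cite: Balaban1985BackgroundPropagators, (3.25) p.394] -/
theorem c_range_of_c_right (c_right : ∀ φ : F, q (g (g (qs (c φ)))) = φ) (f : E) : q (g (g (qs (c (q f))))) = q f :=
  c_right (q f)

/-- **«Q′G′R = 0»** (p. 93) from the RANGE-FORM law of `C`: `Q′G′R f = Q′G′f − (Q′G′²Q′ᵀ)C(Q′(G′f)) = 0`, the law being applied at the range point
`Q′(G′f)`.  Consequently every `λ = G′R Y` obeys `Q′λ = 0`. [cite: Balaban1985RegularSpaces, (1.100) p.93] -/
theorem q_g_proj325_range (hR : ∀ f, R f = f - g (qs (c (q (g f))))) (c_range : ∀ f : E, q (g (g (qs (c (q f))))) = q f) (f : E) :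
    q (g (R f)) = 0 := by
  rw [hR, map_sub, map_sub, c_range, sub_self]

/-- **«ΔG′R = R»** from the right-inverse law of `G′` and `Q′G′R = 0` (range form). [cite: Balaban1985RegularSpaces, (1.95) p.92] -/
theorem lap_g_proj325_range (hR : ∀ f, R f = f - g (qs (c (q (g f)))))
    (g_right : ∀ x : E, Δ (g x) + qs (A (q (g x))) = x) (c_range : ∀ f : E, q (g (g (qs (c (q f))))) = q f) (f : E) :
    Δ (g (R f)) = R f := by
  have h1 := g_right (R f)
  rw [q_g_proj325_range hR c_range f, map_zero, map_zero, add_zero] at h1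
  exact h1

/-- `R² = R` (range form). [cite: Balaban1985BackgroundPropagators, (3.25) p.394] -/
theorem proj325_idem_range (hR : ∀ f, R f = f - g (qs (c (q (g f)))))
    (c_range : ∀ f : E, q (g (g (qs (c (q f))))) = q f) (f : E) : R (R f) = R f := by
  conv_lhs => rw [hR, q_g_proj325_range hR c_range f]
  rw [map_zero, map_zero, map_zero, sub_zero]

/-- **(1.95) ⟺ (1.100)** (range form): `λ = G′R Y ⟺ (Q′λ = 0 ∧ Δλ = R Y)`. [cite: Balaban1985RegularSpaces, (1.100) p.93] -/
theorem eq_g_proj325_iff_range (hR : ∀ f, R f = f - g (qs (c (q (g f)))))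
    (g_left : ∀ x : E, g (Δ x + qs (A (q x))) = x) (g_right : ∀ x : E, Δ (g x) + qs (A (q (g x))) = x)
    (c_range : ∀ f : E, q (g (g (qs (c (q f))))) = q f) (lam Y : E) :
    lam = g (R Y) ↔ q lam = 0 ∧ Δ lam = R Y := by
  constructor
  · rintro rfl
    exact ⟨q_g_proj325_range hR c_range Y, lap_g_proj325_range hR g_right c_range Y⟩
  · rintro ⟨hq, hlap⟩
    have := g_left lam
    rw [hq, map_zero, map_zero, add_zero, hlap] at this
    exact this.symm

/-- **THE FIXED-POINT EQUATION ⟺ (LINEARISED RESTRICTION ∧ LANDAU CONDITION OF THE GAUGE-FIXED FIELD)** (range form): for an arbitrary map `N : E → E`,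
`λ = G′R(Y − Nλ) ⟺ Q′λ = 0 ∧ R(Y − Δλ − Nλ) = 0`. [cite: Balaban1985RegularSpaces, (1.90) p.91, (1.95)–(1.100) pp.92–93] -/
theorem fixedPoint_iff_constraint_and_landau_range (hR : ∀ f, R f = f - g (qs (c (q (g f)))))
    (g_left : ∀ x : E, g (Δ x + qs (A (q x))) = x) (g_right : ∀ x : E, Δ (g x) + qs (A (q (g x))) = x)
    (c_range : ∀ f : E, q (g (g (qs (c (q f))))) = q f) (N : E → E) (lam Y : E) :
    lam = g (R (Y - N lam)) ↔ q lam = 0 ∧ R (Y - Δ lam - N lam) = 0 := by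
  rw [eq_g_proj325_iff_range hR g_left g_right c_range lam (Y - N lam)]
  constructor
  · rintro ⟨hq, hlap⟩
    refine ⟨hq, ?_⟩
    rw [sub_right_comm, lap_eq_proj325_iff_of_ker hR g_left hq]
    exact hlap
  · rintro ⟨hq, hlan⟩
    refine ⟨hq, ?_⟩
    rw [sub_right_comm, lap_eq_proj325_iff_of_ker hR g_left hq] at hlan
    exact hlan

/-- **THE SAME WITH THE LANDAU CONDITION IN MULTIPLIER FORM** (range form for `c_right`; `c_left` as in `B8Eq195Linear`): `λ = G′R(Y − Nλ) ⟺ Q′λ = 0 ∧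
∃ μ, Δ(Y − Δλ − Nλ) = Q′ᵀ μ`. [cite: Balaban1985RegularSpaces, (1.100) p.93, (1.38) p.82; Balaban1985BackgroundPropagators, (3.25) p.394] -/
theorem fixedPoint_iff_constraint_and_multiplier_range (hR : ∀ f, R f = f - g (qs (c (q (g f)))))
    (g_left : ∀ x : E, g (Δ x + qs (A (q x))) = x) (g_right : ∀ x : E, Δ (g x) + qs (A (q (g x))) = x)
    (c_left : ∀ φ : F, c (q (g (g (qs φ)))) = φ) (c_range : ∀ f : E, q (g (g (qs (c (q f))))) = q f) (N : E → E) (lam Y : E) :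
    lam = g (R (Y - N lam)) ↔ q lam = 0 ∧ ∃ μ : F, Δ (Y - Δ lam - N lam) = qs μ := by
  rw [fixedPoint_iff_constraint_and_landau_range hR g_left g_right c_range N lam Y, hR,
    proj325_apply_eq_zero_iff_exists g_left g_right c_left]

end Skeleton

#print axioms fixedPoint_iff_constraint_and_multiplier_range

end Literature.MathematicalPhysics.QuantumFieldTheory.Balaban1983to89.B8Eq195LinearRange
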